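import Literature.MathematicalPhysics.QuantumFieldTheory.Balaban1983to89.B8Prop6Reg335ZdAllTorus
import Literature.MathematicalPhysics.QuantumFieldTheory.Balaban1983to89.B8ConstraintBonds

/-!
# `Balaban1983to89.B8Prop6Reg335ZdLawMember` — [Balaban1985RegularSpaces] PROPOSITION 6's PRINTED APPLICATION AT THE FRAME OF RECORD, AT PRINT's
# ADMITTED MEMBERS: for every `ℤᵈ` datum `i` with `Ω₀ = ℤᵈ` and the domain laws (1.3)–(1.4) (`B8ConstraintBonds.DomainSeq L i.Ω`), every block
# parameter `M ≥ 11d + 1` and every truncation `m`, dag-n06-b's junction binder `Prop6At (bgZd 𝔸 L) L memZd (ιCfgZd 𝔸 L) c35 c₆ K₆ M i m` («(3.35) for U₀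
# by Proposition 6») HOLDS — unconditional for `d ≥ 2`, odd `L ≥ 5`; the all-torus restriction of `B8Prop6Reg335ZdAllTorus` is removed by LOWERING THE
# INDEX of the print cube by a fixed number `s` of scales, so that ONE application of the separation law `DomainSeq.sep` hosts print's collars

statement-level skeleton of published theorems with citation tags; proofs where landed; nothing here is a claim about the
Yang–Mills mass gap

PDF held: `paper:balaban1985-cmp99-regular-spaces-gauge-fixing` p. 77 (p0003: (1.3)–(1.4) «(Lʲη)⁻¹dist(Ω_jᶜ, Ω_{j+1}) > RM₁ … R is a sufficiently large
positive integer (a power of L)»; «we admit the case where some domains Ω_j are equal to T_η»), p. 98–99 (p0024–p0025: «Now let us take a cube □ ⊂ Ω₀ for which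
we want to prove the condition (3.35) … We assume that the cube □ is contained in Ω_j, and not in Ω_{j+1} … Without a loss of generality we can assume also
that j = k, because we can drop out the domains Ω_{j′}, j′ > j, from our assumptions, and change a scale»; Proposition 6; «hence … we have proved the
regularity condition (3.35). This implies that we can drop out this condition from the assumption (1.33)»); [4] = [Balaban1985BackgroundPropagators] p. 396
(the cube class; (3.35)).  Read on the held text layer by this seat (2026-08-28).

WHY THIS FILE (cell `pub-ymgap`, YM-PLAN Track A node N05, FAN-OUT §N05 row s3b; seat `pub-ymgap-dag-n05-e` (g14); count-neutral).  `B8Prop6Reg335ZdAllTorus`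
(p611683) made dag-n06-b's junction binder `Prop6At` a theorem at dag-n06-e's frame `bgZd` for the ALL-TORUS members and located the law-member case on
the room print's collars need (`Node00.CubeB8.tcube_sub`: «□̃ ⊂ Ω_{k−1}», an overhang `2R₁M₁Lᵏ` beyond `□ ⊂ Ω_k`) against the tree's separation law
`B8ConstraintBonds.DomainSeq.sep` (the ℓ^∞-ball of radius `Lʲ` about `Ω_j` lies in `Ω_{j−1}`: (1.4) in its weakest reading `RM₁ ≥ L`).  The gap closes
WITHOUT a stronger law (print: «change a scale»): serve a class cube `(□, j)`, `□ ⊆ Ω_j`, by Proposition 6 at a print cube of index `j − s`, `s` fixed with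
`4R₁M₁L ≤ L^s`; box and collar then overhang `□` by `≤ 4R₁M₁L·L^{j−s} ≤ Lʲ`, inside `sep`'s ball, hence inside `Ω_{j−1} ⊆ Ω_{j−s} ∩ Ω_{j−s−1}`; the (3.35)
bounds come at scale `L^{j−s}η` and are re-read at scale `Lʲη` at the price `L^{2s}` in [4]'s O(1) (a function of `d, L` only, as print requires); class cubes
of index `j ≤ s` get the axial-gauge clause of `B8Prop6Reg335Cube` §2 re-read at scale `Lʲη`.  N05's record road (the b9 socket of the «P₂C» knits, to be
supplied from N06's Theorem 3.3 through dag-n06-b's member suppliers, whose hypotheses include `Prop6At` at the law members) thereby loses its [B8]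
Proposition-6 hypothesis at the frame of record, as the all-torus consumers (N16 ∕ N27 ∕ K3) did.

WHAT IS PROVED (kernel-checked; 0 sorry; 0 def; `𝔸 : Type` a nontrivial C⋆-algebra for §3–§4).
* §1 `reg335Cube_mono` (the clause weakens as `C` grows), `reg335Cube_rescale` (a clause at scale `ξ` with constant `C` is a clause at scale `Λξ`, `Λ ≥ 1`,
  with constant `C·Λ²`), `reg335Cube_lowIndex_of_plaq` (= `B8Prop6Reg335Cube.reg335Cube_index_zero` re-read at scale `Lʲη`, constant `C·L^{2j}`).
* §2 ★ `exists_printCube_over_classCube_of_sep` — **THE INSCRIPTION UNDER (1.3)–(1.4)**: `DomainSeq L Ω`, a p. 396 class cube `(□, j)` with `□ ⊆ Ω_j`,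
  `s + 1 ≤ j ≤ m`, `4ρ₀L ≤ L^s`, `11d + 1 ≤ M` ⊢ a print cube `c : Node00.CubeB8 d L m Ω`, `c.IsPrint ρ₀`, `c.k = j − s`, `□ ⊆ box L c.a c.M c.k`,
  `c.M ≤ 10⌈M⌉₊L^s + 2ρ₀` (corner = `□`'s corner on the `L^{j−s}`-lattice rounded down to the `ρ₀`-grid; side = the least multiple of `ρ₀` above
  `n⌈M⌉₊L^s + ρ₀`; collar `ρ₀L`; its two containments `box ⊆ Ω_{j−s}`, `□̃ ⊆ Ω_{j−s−1}` by ONE `DomainSeq.sep` from a coordinatewise clamp of `□̃` onto `□`).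
* §3 ★★ `prop6At_bgZd_lawMember_of_prop6Printed` — for `d ≥ 2`, `L ≥ 2`, `ρ₀ ≥ 1`, `s` with `4ρ₀L ≤ L^s`, `B₁ ≥ 0`, `c₁ > 0` and `B8.Prop6Printed d L B₁ c₁
  (zdCubP 𝔸 L ρ₀ ∘ f)` for every `f`: at every `i : ZdIdx d L` with `i.Ω 0 = univ` and `DomainSeq L i.Ω`, every `M ≥ 11d + 1`, every `m`,
  `Prop6At (bgZd 𝔸 L) L memZd (ιCfgZd 𝔸 L) c35 c₆ 1 M i m` with `c35 := (7dL²B₁(20L^s + 2ρ₀) + 84dL^s + 1)·L^{2s}`,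
  `c₆ := min (1∕(42dL^s)) (c₁∕(7dL²(20L^s + 2ρ₀)))`; Proposition 6 is applied at the auxiliary LAWFUL datum `⟨i.η, m, i.Ω, Λs ≡ level-0 sites, Λb ≡ ∅⟩`
  built inline (Prop. 6's carrier reads `(k, η, Ω)` only).
* §4 ★★★ `prop6At_bgZd_lawMember_holds` (`d ≥ 2`, `L ≥ 5` odd, `s := 4ρ₀L`) — UNCONDITIONAL ∃-form — and `prop6At_binder_lawMembers_holds`, the binder in the
  N05-road shape `∀ M i m, i.Ω 0 = univ → DomainSeq L i.Ω → M₃ ≤ M → Prop6At (bgZd 𝔸 L) L memZd (ιCfgZd 𝔸 L) c35 c₆ K₆ M i m` with `M₃ = 11d + 1`.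
HONEST SCOPE.  (a) Members with `Ω₀ = ℤᵈ` and `DomainSeq` (print's admitted sequences at `Ω₀ = T`, (1.3)–(1.4) in the tree's weakest reading); `M ≥ 11d + 1`
(print's «11d < M» side of the Prop-6 cube, GAPS G-B8-14) — the binder's `M₃` slot.  (b) Constants explicit, astronomically non-optimal (`s = 4ρ₀L` in §4;
any `s` with `4ρ₀L ≤ L^s` in §3) but functions of `d, L` (and F1's `ρ₀, B₁, c₁`) only; monotone in `c35` (`B8Prop6Reg335ZdAllTorus.prop6At_bgZd_mono`).
(c) NOTHING of [4] is touched; (3.36) not produced; Proposition 6 CONSUMED by name (§3 hypothesis ∕ §4 `prop6Printed_zdCubP_γ_holds`).  (d) The all-torus file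
stands (its `M₃ = 1` and smaller constants).  Count-neutral; N05 ∕ N06 NOT discharged; one finite lattice programme at fixed spacing, Bałaban AS PRINTED; nothing
continuum ∕ ℝ⁴ ∕ OS ∕ mass-gap ∕ Clay.  No `sorry`, no `axiom`, no definition, no `instance`, no `notation`.  Unit `pub-ymgap-dag-n05-e` (g14), 2026-08-28.
-/

noncomputable section

open NormedSpace

namespace Literature.MathematicalPhysics.QuantumFieldTheory.Balaban1983to89.B8Prop6Reg335ZdLawMember

open B7Prop1Explicit B7Prop2Explicit B7Prop1Local
open B8Ineq130 (tlo thi tlo_zero thi_zero)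
open B8Ineq132 (InAk CondAt plaqF PlaqTouches)
open B8LeafModelZd (ZdIdx)
open B8Eq131Cubes (box cube tcube bLo bHi tLo tHi tcube_eq box_subset_cube_top cube_subset_tcube)
open B8Eq133Hypotheses (Reg335Zd shiftT byDir)
open B9Eq335RegularityClasses (Reg335Cube Reg335)
open B8ConstraintBonds (DomainSeq)
open LatticeNorms (scaleLen scaleLen_pos)
open B9SupplySockB9P3ZdAt (Prop6At)
open B9SupplySockB9P3ZdFrame (MemberZd memZd bgZd ιCfgZd cubeClass396Zd IsCube396Zd boxZd bigSideZd OmTrunc reg335_bgZd_iff)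
open B8Prop6Reg335Cube (reg335Cube_of_gaugedBoundB8 reg335Cube_index_zero)
open B8Prop6Reg335ZdAllTorus (l1_le_of_mem_boxZd prop6At_bgZd_mono)
open B8Prop6PrintedZdCubPGamma (prop6Printed_zdCubP_γ_holds)
open Node00 (CubeB8 GaugedBoundB8 zdCubP prop6Printed_zdCubP_iff)

variable {d : ℕ}

/-! ## §1 The (3.35)-clause: monotone in the constant, re-readable at a coarser scale -/

section Clause

variable {𝔸 : Type*} [NormedRing 𝔸] [NormedAlgebra ℂ 𝔸] [CompleteSpace 𝔸]
variable {S : Type*} {ι : Type*} (T : ι → Equiv.Perm S) (U : ι → S → 𝔸ˣ)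

/-- The (3.35)-clause on a cube weakens as the constant grows ([4]'s «O(1)» is any admissible number). [cite: Balaban1985BackgroundPropagators, (3.35) p.396] -/
theorem reg335Cube_mono {η : ℝ} {Q : Set S} {ξ C C' : ℝ} (hξ : 0 < ξ) (hC : C ≤ C') (h : Reg335Cube T U η Q ξ C) :
    Reg335Cube T U η Q ξ C' := by
  obtain ⟨u, A, hu, hrep, hA, hD⟩ := h
  exact ⟨u, A, hu, hrep, fun κ z hz => (hA κ z hz).trans_le (mul_le_mul_of_nonneg_right hC (inv_nonneg.mpr hξ.le)),
    fun κ ν z hz => (hD κ ν z hz).trans_le (mul_le_mul_of_nonneg_right hC (inv_nonneg.mpr (pow_nonneg hξ.le 2)))⟩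

/-- **RE-READING A CLAUSE AT A COARSER SCALE** (print p. 98: «change a scale»): `|A| < Cξ⁻¹`, `|∇^ηA| < Cξ⁻²` give `|A| < CΛ²(Λξ)⁻¹`, `|∇^ηA| < CΛ²(Λξ)⁻²` for every
`Λ ≥ 1` (`C ≥ 0`). [cite: Balaban1985RegularSpaces, p.98 («and change a scale»); Balaban1985BackgroundPropagators, (3.35) p.396] -/
theorem reg335Cube_rescale {η : ℝ} {Q : Set S} {ξ Λ C : ℝ} (hξ : 0 < ξ) (hΛ : 1 ≤ Λ) (hC : 0 ≤ C) (h : Reg335Cube T U η Q ξ C) :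
    Reg335Cube T U η Q (Λ * ξ) (C * Λ ^ 2) := by
  obtain ⟨u, A, hu, hrep, hA, hD⟩ := h
  have hΛ0 : 0 < Λ := lt_of_lt_of_le one_pos hΛ
  have h1 : C * ξ⁻¹ ≤ C * Λ ^ 2 * (Λ * ξ)⁻¹ := by
    rw [show C * Λ ^ 2 * (Λ * ξ)⁻¹ = (C * ξ⁻¹) * Λ by field_simp]
    exact le_mul_of_one_le_right (by positivity) hΛ
  have h2 : C * (ξ ^ 2)⁻¹ = C * Λ ^ 2 * ((Λ * ξ) ^ 2)⁻¹ := by field_simp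
  exact ⟨u, A, hu, hrep, fun κ z hz => (hA κ z hz).trans_le h1, fun κ ν z hz => (hD κ ν z hz).trans_eq h2⟩

end Clause

section LowIndex

variable {𝔸 : Type*} [NormedRing 𝔸] [NormedAlgebra ℂ 𝔸] [CompleteSpace 𝔸] [NormOneClass 𝔸]

/-- **(3.35) AT A CUBE OF LOW INDEX `j` FROM THE PLAQUETTE RADIUS ALONE**: `B8Prop6Reg335Cube.reg335Cube_index_zero` (the axial gauge at scale `η`) re-read at scale
`Lʲη` — constant `C·L^{2j}`. [cite: Balaban1985RegularSpaces, p.98, (1.7) p.77; Balaban1985BackgroundPropagators, (3.35) p.396; Balaban1985Averaging, pp.24–25] -/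
theorem reg335Cube_lowIndex_of_plaq {V : B7Prop1Explicit.Site d → Fin d → 𝔸ˣ} (hV : ∀ x κ, V x κ ∈ U1 𝔸) {η : ℝ} (hη : 0 < η) {L : ℕ} (hL : 1 ≤ L) (j : ℕ)
    {α D : ℝ} (hα : 0 ≤ α) (hD : 0 ≤ D) (hsmall : (D + 1) * α ≤ 1 / 2)
    (h44 : ∀ (x : B7Prop1Explicit.Site d) (κ μ : Fin d), κ ≠ μ → ‖((hol V x (plaqWord κ μ) : 𝔸ˣ) : 𝔸) - 1‖ ≤ α)
    {Q : Set (B7Prop1Explicit.Site d)} {y : B7Prop1Explicit.Site d} (hQ : ∀ z ∈ Q, (l1 (z - y) : ℝ) ≤ D) {C : ℝ} (hC : 4 * (D + 1) * α < C) :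
    Reg335Cube (shiftT d) (byDir V) η Q (scaleLen (L : ℝ) η j) (C * ((L : ℝ) ^ j) ^ 2) := by
  have h0 := reg335Cube_index_zero hV hη L hα hD hsmall h44 hQ hC
  have hL1 : (1 : ℝ) ≤ (L : ℝ) ^ j := one_le_pow₀ (by exact_mod_cast hL)
  have hC0 : 0 ≤ C := le_trans (by positivity) hC.le
  have h1 := reg335Cube_rescale (shiftT d) (byDir V) (Λ := (L : ℝ) ^ j) (scaleLen_pos (by exact_mod_cast (lt_of_lt_of_le one_pos hL)) hη 0) hL1 hC0 h0
  have hsc : (L : ℝ) ^ j * scaleLen (L : ℝ) η 0 = scaleLen (L : ℝ) η j := by simp [scaleLen]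
  rwa [hsc] at h1

end LowIndex

/-! ## §2 The inscription of a p. 396 class cube into a print cube of LOWER index, under (1.3)–(1.4) -/

/-- The coordinatewise clamp onto an integer interval `[c, c + S)`: a point within the overhangs `B` of the interval on either side is within `B` of its clamp
(bookkeeping for the collar of p. 98). [cite: Balaban1985RegularSpaces, p.98 (bookkeeping)] -/
theorem clamp_int (z c S lo hi B : ℤ) (hS : 1 ≤ S) (hB : 0 ≤ B) (hlo : lo ≤ z) (hhi : z ≤ hi) (h1 : c - lo ≤ B) (h2 : hi - (c + S - 1) ≤ B) :
    ∃ x : ℤ, c ≤ x ∧ x < c + S ∧ |z - x| ≤ B := by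
  refine ⟨if z < c then c else if c + S ≤ z then c + S - 1 else z, ?_, ?_, ?_⟩
  · split_ifs <;> omega
  · split_ifs <;> omega
  · rw [abs_le]; split_ifs <;> constructor <;> omega


/-- ★ **THE INSCRIPTION UNDER (1.3)–(1.4)** (print p. 98 «we take a size of □ equal to MLʲη, where M is a multiple of R₁M₁ … we can drop out the domains Ω_{j′}, j′ > j,
from our assumptions, and change a scale»; (1.4) p. 77): for a domain sequence `Ω` with the laws `DomainSeq L Ω` (`L ≥ 2`), a big-block size `ρ₀ ≥ 1`, an
exponent `s` with `4ρ₀L ≤ L^s`, a block parameter `M ≥ 11d + 1` and a p. 396 class cube `□` of index `j` (`IsCube396Zd M L j □`) with `□ ⊆ Ω_j`,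
`s + 1 ≤ j ≤ m`: there is a print cube `c : CubeB8 d L m Ω` at `ρ₀` of index `c.k = j − s` with `□ ⊆ box L c.a c.M c.k` and `c.M ≤ 10⌈M⌉₊L^s + 2ρ₀` — its
box and its `□̃` overhang `□` by at most `4ρ₀L·L^{j−s} ≤ Lʲ` fine sites, inside the ball that `DomainSeq.sep` places in `Ω_{j−1}`.
[cite: Balaban1985RegularSpaces, p.98, (1.3)–(1.4) p.77, (1.130) p.99; Balaban1985BackgroundPropagators, p.396 (the cube class)] -/
theorem exists_printCube_over_classCube_of_sep (hd : 1 ≤ d) {L : ℕ} (hL : 2 ≤ L) {ρ₀ : ℕ} (hρ₀ : 1 ≤ ρ₀) {s : ℕ} (hs : 4 * ρ₀ * L ≤ L ^ s)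
    {Ω : ℕ → Set (B7Prop1Explicit.Site d)} (hDS : DomainSeq L Ω) {M : ℝ} (hM : (11 * d + 1 : ℝ) ≤ M) {j m : ℕ} (hsj : s + 1 ≤ j) (hjm : j ≤ m)
    {Q : Set (B7Prop1Explicit.Site d)} (hQ : IsCube396Zd M L j Q) (hQΩ : Q ⊆ Ω j) :
    ∃ c : CubeB8 d L m Ω, c.IsPrint ρ₀ ∧ c.k = j - s ∧ Q ⊆ box L c.a c.M c.k ∧ (c.M : ℝ) ≤ 10 * ⌈M⌉₊ * (L : ℝ) ^ s + 2 * ρ₀ := by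
  obtain ⟨c₀, n, hn1, hn10, hdvd, rfl⟩ := hQ
  have hL1 : 1 ≤ L := le_trans one_le_two hL
  -- the lowered index `k' = j − s ≥ 1` and the two sides: `S' = n⌈M⌉₊L^s` (in `L^{k'}`-blocks), `S = S'·L^{k'}` (fine)
  have hs1 : 1 ≤ s := by
    rcases Nat.eq_zero_or_pos s with h0 | h0
    · exfalso
      rw [h0, pow_zero] at hs
      have : 4 * 1 * 2 ≤ 4 * ρ₀ * L := Nat.mul_le_mul (Nat.mul_le_mul_left 4 hρ₀) hL
      omega
    · exact h0
  set k' : ℕ := j - s with hk'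
  clear_value k'
  have hk'1 : 1 ≤ k' := by omega
  have hjk : j = s + k' := by omega
  set S' : ℕ := n * ⌈M⌉₊ * L ^ s with hS'
  clear_value S'
  have hceilM : 11 * d + 1 ≤ ⌈M⌉₊ := by
    have : ((11 * d + 1 : ℕ) : ℝ) ≤ M := by exact_mod_cast hM
    exact Nat.cast_le.mp (this.trans (Nat.le_ceil M))
  have hLs : 1 ≤ L ^ s := Nat.one_le_pow _ _ hL1
  have hS'ge : ⌈M⌉₊ ≤ S' := by
    rw [hS']
    calc ⌈M⌉₊ = 1 * ⌈M⌉₊ * 1 := by ring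
      _ ≤ n * ⌈M⌉₊ * L ^ s := Nat.mul_le_mul (Nat.mul_le_mul_right _ hn1) hLs
  have hS'geLs : L ^ s ≤ S' := by
    rw [hS']; exact Nat.le_mul_of_pos_left _ (Nat.mul_pos (by omega) (by omega))
  have hρ0 : (0 : ℤ) < (ρ₀ : ℤ) := by exact_mod_cast hρ₀
  have hLk : (0 : ℤ) < (L : ℤ) ^ k' := by positivity
  -- the fine side is `S'·L^{k'}`
  have hside : ((n * bigSideZd M L j : ℕ) : ℤ) = (S' : ℤ) * (L : ℤ) ^ k' := by
    rw [hS', hjk]; push_cast [bigSideZd]; ring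
  -- corner `a₀ = c₀ / L^{k'}` (exact), rounded down to the `ρ₀`-grid: `a`
  have hdvdL : ∀ μ, ((L : ℤ) ^ k') ∣ c₀ μ := fun μ => by
    refine dvd_trans ?_ (hdvd μ)
    refine ⟨(⌈M⌉₊ : ℤ) * (L : ℤ) ^ s, ?_⟩
    rw [hjk]; push_cast [bigSideZd]; ring
  obtain ⟨a₀, hc₀⟩ : ∃ a₀ : B7Prop1Explicit.Site d, ∀ μ, c₀ μ = (L : ℤ) ^ k' * a₀ μ :=
    ⟨fun μ => c₀ μ / (L : ℤ) ^ k', fun μ => (Int.mul_ediv_cancel' (hdvdL μ)).symm⟩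
  obtain ⟨a, ha_def⟩ : ∃ a : B7Prop1Explicit.Site d, ∀ μ, a μ = a₀ μ / (ρ₀ : ℤ) * (ρ₀ : ℤ) := ⟨fun μ => a₀ μ / (ρ₀ : ℤ) * (ρ₀ : ℤ), fun μ => rfl⟩
  have ha_le : ∀ μ, a μ ≤ a₀ μ := fun μ => by rw [ha_def]; exact Int.ediv_mul_le _ hρ0.ne'
  have ha_lt : ∀ μ, a₀ μ < a μ + ρ₀ := fun μ => by
    have h1 := Int.emod_lt_of_pos (a₀ μ) hρ0
    have h2 : a₀ μ % ρ₀ = a₀ μ - a μ := by rw [Int.emod_def, ha_def]; ring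
    linarith
  -- the side `Mc` = the least multiple of `ρ₀` above `S' + ρ₀`
  set Mc : ℕ := (S' / ρ₀ + 2) * ρ₀ with hMc
  clear_value Mc
  have hMc_ge : S' + ρ₀ ≤ Mc := by
    rw [hMc]
    have h1 := Nat.div_add_mod S' ρ₀
    have h2 := Nat.mod_lt S' (by omega : 0 < ρ₀)
    have h3 : (S' / ρ₀ + 2) * ρ₀ = ρ₀ * (S' / ρ₀) + 2 * ρ₀ := by ring
    linarith
  have hMc_le : Mc ≤ S' + 2 * ρ₀ := by
    rw [hMc]
    have h1 := Nat.div_mul_le_self S' ρ₀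
    have h3 : (S' / ρ₀ + 2) * ρ₀ = S' / ρ₀ * ρ₀ + 2 * ρ₀ := by ring
    linarith
  have h4ρL : ρ₀ * L ≤ L ^ s := by
    have : ρ₀ * L ≤ 4 * (ρ₀ * L) := Nat.le_mul_of_pos_left _ (by norm_num)
    have e : 4 * (ρ₀ * L) = 4 * ρ₀ * L := by ring
    omega
  have hρL : ρ₀ * L ≤ Mc := by omega
  have hbig : 11 * d < Mc := by omega
  have hLρ : L ≤ ρ₀ * L := Nat.le_mul_of_pos_left L (by omega)
  have hLdM : L ≤ d * Mc := (hLρ.trans hρL).trans (Nat.le_mul_of_pos_left _ hd)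
  -- THE ROOM: every site of `□̃(a, Mc, ρ₀L, k')` is within `Lʲ` (ℓ^∞) of a site of `□`, hence in `Ω_{j−1}` by `DomainSeq.sep`
  have hover : (L : ℤ) ^ k' * ρ₀ + (L : ℤ) ^ k' * (2 * ρ₀) + (L : ℤ) ^ k' * (2 * (ρ₀ * L)) ≤ (L : ℤ) ^ j := by
    have hL2 : (2 : ℤ) ≤ L := by exact_mod_cast hL
    have h0 : (ρ₀ : ℤ) * 2 ≤ ρ₀ * L := mul_le_mul_of_nonneg_left hL2 hρ0.le
    have h1 : (ρ₀ : ℤ) + 2 * ρ₀ + 2 * (ρ₀ * L) ≤ 4 * ρ₀ * L := by linarith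
    have h2 : (4 * ρ₀ * L : ℤ) ≤ (L : ℤ) ^ s := by exact_mod_cast hs
    have h3 := mul_le_mul_of_nonneg_left (h1.trans h2) hLk.le
    have h4 : (L : ℤ) ^ k' * (L : ℤ) ^ s = (L : ℤ) ^ j := by rw [← pow_add, hjk, add_comm]
    linarith
  have hS1 : (1 : ℤ) ≤ (S' : ℤ) * (L : ℤ) ^ k' := by
    have h1 : (1 : ℤ) ≤ S' := by exact_mod_cast (le_trans hLs hS'geLs)
    have h2 : (1 : ℤ) ≤ (L : ℤ) ^ k' := one_le_pow₀ (by exact_mod_cast hL1)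
    exact one_le_mul_of_one_le_of_one_le h1 h2
  have e4 : (S' : ℤ) + ρ₀ ≤ Mc := by exact_mod_cast hMc_ge
  have e5 : (Mc : ℤ) ≤ S' + 2 * ρ₀ := by exact_mod_cast hMc_le
  have hm2 : (((L ^ k' * (2 * (ρ₀ * L)) : ℕ) : ℤ)) = (L : ℤ) ^ k' * (2 * (ρ₀ * L)) := by push_cast; ring
  have htcube : tcube L a Mc (ρ₀ * L) k' ⊆ Ω (j - 1) := by
    intro z hz
    rw [tcube_eq] at hz
    -- per coordinate: the two overhangs are `≤ Lʲ`, so the clamp of `z μ` onto `[c₀ μ, c₀ μ + S)` is within `Lʲ`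
    have hcl : ∀ μ, ∃ xμ : ℤ, c₀ μ ≤ xμ ∧ xμ < c₀ μ + (S' : ℤ) * (L : ℤ) ^ k' ∧ |z μ - xμ| ≤ (L : ℤ) ^ j := fun μ => by
      obtain ⟨hlo, hhi⟩ := hz μ
      simp only [bLo, bHi, hm2] at hlo hhi
      have f1 := hc₀ μ
      have f2 : (L : ℤ) ^ k' * a μ ≤ (L : ℤ) ^ k' * a₀ μ := mul_le_mul_of_nonneg_left (ha_le μ) hLk.le
      have f3 : (L : ℤ) ^ k' * a₀ μ ≤ (L : ℤ) ^ k' * (a μ + ρ₀) := mul_le_mul_of_nonneg_left (ha_lt μ).le hLk.le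
      have f4 : (L : ℤ) ^ k' * (Mc : ℤ) ≤ (L : ℤ) ^ k' * (S' + 2 * ρ₀) := mul_le_mul_of_nonneg_left e5 hLk.le
      have f5 : 0 ≤ (L : ℤ) ^ k' * ρ₀ := by positivity
      refine clamp_int (z μ) (c₀ μ) ((S' : ℤ) * (L : ℤ) ^ k') _ _ ((L : ℤ) ^ j) hS1 (by positivity) hlo hhi ?_ ?_
      · linarith
      · linarith
    choose x hx using hcl
    have hxQ : x ∈ boxZd c₀ (n * bigSideZd M L j) := by
      intro μ
      rw [hside]
      exact ⟨(hx μ).1, (hx μ).2.1⟩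
    have hdist : ∀ μ, |(z - x) μ| ≤ (L : ℤ) ^ j := fun μ => by rw [Pi.sub_apply]; exact (hx μ).2.2
    have hj1 : j - 1 + 1 = j := by omega
    have hxΩ : x ∈ Ω (j - 1 + 1) := by rw [hj1]; exact hQΩ hxQ
    have h := hDS.sep (j - 1) x (z - x) hxΩ (by rw [hj1]; exact hdist)
    have e : x + (z - x) = z := by abel
    rwa [e] at h
  have hk'j : k' ≤ j - 1 := by omega
  have hboxΩ : box L a Mc k' ⊆ Ω k' := fun z hz =>
    hDS.anti_le hk'j (htcube (cube_subset_tcube hL (le_trans hL1 hLρ) le_rfl (box_subset_cube_top L a Mc (ρ₀ * L) k' hz)))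
  have htcubeΩ : tcube L a Mc (ρ₀ * L) k' ⊆ Ω (k' - 1) := fun z hz => hDS.anti_le (by omega) (htcube hz)
  -- the cube
  let c : CubeB8 d L m Ω := ⟨k', a, Mc, ρ₀ * L, hk'1, by omega, hLρ, hρL, hbig, hLdM, hboxΩ, htcubeΩ⟩
  have hcM : c.M = Mc := rfl
  have hca : c.a = a := rfl
  have hck : c.k = k' := rfl
  have hcρ : c.ρ = ρ₀ * L := rfl
  refine ⟨c, ⟨?_, ?_, fun μ => ?_⟩, hck, ?_, ?_⟩
  · rw [hcρ]; exact Dvd.intro L rfl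
  · rw [hcM, hMc]; exact Dvd.intro_left _ rfl
  · rw [hca, ha_def]; exact Dvd.intro (a₀ μ / ρ₀) (by ring)
  · -- `□ ⊆ box L a Mc k'`
    rw [hca, hcM, hck]
    intro x hx μ
    obtain ⟨h1, h2⟩ := hx μ
    rw [hside] at h2
    have e4 : (S' : ℤ) + ρ₀ ≤ Mc := by exact_mod_cast hMc_ge
    show bLo L a k' 0 μ ≤ x μ ∧ x μ ≤ bHi L a Mc k' 0 μ
    simp only [bLo, bHi, Nat.cast_zero, sub_zero, add_zero]
    constructor
    · calc (L : ℤ) ^ k' * a μ ≤ (L : ℤ) ^ k' * a₀ μ := mul_le_mul_of_nonneg_left (ha_le μ) hLk.le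
        _ = c₀ μ := (hc₀ μ).symm
        _ ≤ x μ := h1
    · have h4 : x μ < (L : ℤ) ^ k' * (a μ + ρ₀ + S') := by
        calc x μ < c₀ μ + S' * (L : ℤ) ^ k' := h2
          _ = (L : ℤ) ^ k' * (a₀ μ + S') := by rw [hc₀ μ]; ring
          _ ≤ (L : ℤ) ^ k' * (a μ + ρ₀ + S') := mul_le_mul_of_nonneg_left (by linarith [ha_lt μ]) hLk.le
      have h5 : (L : ℤ) ^ k' * (a μ + ρ₀ + S') ≤ (L : ℤ) ^ k' * (a μ + Mc) := mul_le_mul_of_nonneg_left (by linarith) hLk.le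
      linarith
  · -- the size
    rw [hcM]
    have h1 : (Mc : ℝ) ≤ S' + 2 * ρ₀ := by exact_mod_cast hMc_le
    have h2 : (S' : ℝ) ≤ 10 * ⌈M⌉₊ * (L : ℝ) ^ s := by
      have : S' ≤ 10 * ⌈M⌉₊ * L ^ s := by rw [hS']; exact Nat.mul_le_mul_right _ (Nat.mul_le_mul_right _ hn10)
      exact_mod_cast this
    linarith

/-! ## §3 (3.35) for `U₀ ∈ 𝔄_m` by Proposition 6, at the frame of record, at every member with `Ω₀ = ℤᵈ` and (1.3)–(1.4) -/

section AtFrame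

variable {𝔸 : Type} [CStarAlgebra 𝔸] [Nontrivial 𝔸]

/-- ★★ **(3.35) FOR `U₀ ∈ 𝔄_m({Ω_j}, α₀)` BY PROPOSITION 6, AT THE FRAME OF RECORD, AT PRINT's ADMITTED MEMBERS** (p. 99 «hence … we have proved the
regularity condition (3.35). This implies that we can drop out this condition from the assumption (1.33)»): for `d ≥ 2`, `L ≥ 2`, `ρ₀ ≥ 1`, `s` with
`4ρ₀L ≤ L^s`, `B₁ ≥ 0`, `c₁ > 0` and `B8.Prop6Printed d L B₁ c₁ (zdCubP 𝔸 L ρ₀ ∘ f)` for every index map `f`: at every `i : ZdIdx d L` with `i.Ω 0 = univ` and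
`DomainSeq L i.Ω`, every `M ≥ 11d + 1`, every truncation `m`, `Prop6At (bgZd 𝔸 L) L memZd (ιCfgZd 𝔸 L) c35 c₆ 1 M i m` with
`c35 := (7dL²B₁(20L^s + 2ρ₀) + 84dL^s + 1)·L^{2s}`, `c₆ := min (1∕(42dL^s)) (c₁∕(7dL²(20L^s + 2ρ₀)))`.  Class cubes of index `j ≤ s`: the axial gauge
(`reg335Cube_lowIndex_of_plaq`, the level-0 clause of `InAk` on `Ω₀ = ℤᵈ`); class cubes of index `j ≥ s + 1`: §2 + Proposition 6 at the auxiliary lawful datum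
`⟨i.η, m, i.Ω, Λs ≡ level-0 sites, Λb ≡ ∅⟩` + `reg335Cube_of_gaugedBoundB8` at scale `L^{j−s}η` + `reg335Cube_rescale` by `L^s`.
[cite: Balaban1985RegularSpaces, Prop. 6 (1.135)–(1.136) p.99, p.98, (1.33) p.82, (1.3)–(1.4) p.77; Balaban1985BackgroundPropagators, (3.35) p.396] -/
theorem prop6At_bgZd_lawMember_of_prop6Printed (hd2 : 2 ≤ d) {L : ℕ} (hL : 2 ≤ L) {ρ₀ : ℕ} (hρ₀ : 1 ≤ ρ₀) {s : ℕ} (hs : 4 * ρ₀ * L ≤ L ^ s)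
    {B₁ c₁ : ℝ} (hB₁ : 0 ≤ B₁) (hc₁ : 0 < c₁)
    (hP6 : ∀ {ι : Type} (f : ι → ZdIdx d L), B8.Prop6Printed d (L : ℝ) B₁ c₁ (fun j => zdCubP 𝔸 L ρ₀ (f j)))
    {M : ℝ} (hM : (11 * d + 1 : ℝ) ≤ M) (i : ZdIdx d L) (hΩ0 : i.Ω 0 = Set.univ) (hDS : DomainSeq L i.Ω) (m : ℕ) :
    Prop6At (bgZd 𝔸 L) L memZd (ιCfgZd 𝔸 L)
      ((7 * d * (L : ℝ) ^ 2 * B₁ * (20 * (L : ℝ) ^ s + 2 * ρ₀) + 84 * d * (L : ℝ) ^ s + 1) * ((L : ℝ) ^ s) ^ 2)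
      (min (1 / (42 * d * (L : ℝ) ^ s)) (c₁ / (7 * d * (L : ℝ) ^ 2 * (20 * (L : ℝ) ^ s + 2 * ρ₀)))) 1 M i m := by
  intro α₀ U₀ hU₀ hα₀ hMα hIn
  rw [reg335_bgZd_iff]
  -- letters and positivity
  have hd1 : 1 ≤ d := le_trans one_le_two hd2
  have hL1 : 1 ≤ L := le_trans one_le_two hL
  have hdR : (1 : ℝ) ≤ d := by exact_mod_cast hd1
  have hLR : (2 : ℝ) ≤ L := by exact_mod_cast hL
  have hρR : (1 : ℝ) ≤ ρ₀ := by exact_mod_cast hρ₀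
  have hd0 : (0 : ℝ) < d := by linarith
  have hL0 : (0 : ℝ) < L := by linarith
  have hρ0 : (0 : ℝ) < ρ₀ := by linarith
  have hLs1 : (1 : ℝ) ≤ (L : ℝ) ^ s := one_le_pow₀ (by linarith)
  have hη : 0 < i.η := i.hη
  have hM1 : (1 : ℝ) ≤ M := le_trans (by linarith) hM
  have hM0 : 0 ≤ M := le_trans zero_le_one hM1
  have hMα' : M * α₀ ≤ 1 / (42 * d * (L : ℝ) ^ s) := hMα.trans (min_le_left _ _)
  have hMα'' : M * α₀ ≤ c₁ / (7 * d * (L : ℝ) ^ 2 * (20 * (L : ℝ) ^ s + 2 * ρ₀)) := hMα.trans (min_le_right _ _)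
  have hceil : (⌈M⌉₊ : ℝ) ≤ 2 * M := by
    have := Nat.ceil_lt_add_one hM0
    linarith
  have hU1 : ∀ x κ, U₀ x κ ∈ U1 𝔸 := fun x κ => unitaryUnits_le_U1 (hU₀ x κ)
  set C : ℝ := (7 * d * (L : ℝ) ^ 2 * B₁ * (20 * (L : ℝ) ^ s + 2 * ρ₀) + 84 * d * (L : ℝ) ^ s + 1) * ((L : ℝ) ^ s) ^ 2 * (memZd M i m).M * (1 * α₀)
    with hC
  clear_value C
  have hCM : (memZd M i m).M = M := rfl
  have hCeq : C = (84 * d * (L : ℝ) ^ s + 1) * M * α₀ * ((L : ℝ) ^ s) ^ 2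
      + 7 * d * (L : ℝ) ^ 2 * B₁ * (20 * (L : ℝ) ^ s + 2 * ρ₀) * ((L : ℝ) ^ s) ^ 2 * M * α₀ := by rw [hC, hCM]; ring
  have hCpart : 0 ≤ 7 * d * (L : ℝ) ^ 2 * B₁ * (20 * (L : ℝ) ^ s + 2 * ρ₀) * ((L : ℝ) ^ s) ^ 2 * M * α₀ := by positivity
  have hCpart' : 0 ≤ 84 * d * (L : ℝ) ^ s * M * α₀ * ((L : ℝ) ^ s) ^ 2 := by positivity
  intro q hq
  obtain ⟨hjm, hcube, hsub, -, -⟩ := hq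
  change q.2 ≤ m at hjm
  change IsCube396Zd M L q.2 q.1 at hcube
  have hsubΩ : q.1 ⊆ i.Ω q.2 := fun z hz => by
    have h := hsub hz
    rw [B9SupplySockB9P3ZdFrame.omTrunc_of_le _ hjm] at h
    exact h
  have hξ : 0 < scaleLen (L : ℝ) i.η q.2 := scaleLen_pos hL0 hη q.2
  rcases Nat.lt_or_ge s q.2 with hsj | hjs
  swap
  · -- LOW INDEX `j ≤ s`: the axial gauge at scale η, re-read at scale `Lʲη`
    obtain ⟨c₀, n, hn1, hn10, -, hQ⟩ := hcube
    have hcond := (hIn 0 (Nat.zero_le m)).1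
    have h44 : ∀ (x : B7Prop1Explicit.Site d) (κ μ : Fin d), κ ≠ μ → ‖((hol U₀ x (plaqWord κ μ) : 𝔸ˣ) : 𝔸) - 1‖ ≤ α₀ := fun x κ μ hκμ => by
      have h := hcond x κ μ hκμ (Or.inl (by rw [hΩ0]; exact Set.mem_univ x))
      simp only [pow_zero, inv_one, one_pow, mul_one] at h
      exact h.le
    have hLj : ((L : ℕ) : ℝ) ^ q.2 ≤ (L : ℝ) ^ s := pow_le_pow_right₀ (by linarith) hjs
    have hrad : ∀ z ∈ q.1, (l1 (z - c₀) : ℝ) ≤ 20 * d * M * (L : ℝ) ^ s := fun z hz => by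
      rw [hQ] at hz
      have h1 := l1_le_of_mem_boxZd hz
      have h2 : (l1 (z - c₀) : ℝ) ≤ d * (n * (⌈M⌉₊ * (L : ℝ) ^ q.2)) := by
        have : ((d * (n * bigSideZd M L q.2) : ℕ) : ℝ) = d * (n * (⌈M⌉₊ * (L : ℝ) ^ q.2)) := by push_cast [bigSideZd]; ring
        rw [← this]; exact_mod_cast h1
      have hn10R : (n : ℝ) ≤ 10 := by exact_mod_cast hn10
      have h3 : (n : ℝ) * (⌈M⌉₊ * (L : ℝ) ^ q.2) ≤ 10 * (2 * M * (L : ℝ) ^ s) :=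
        mul_le_mul hn10R (mul_le_mul hceil hLj (by positivity) (by positivity)) (by positivity) (by norm_num)
      have h4 : (d : ℝ) * (n * (⌈M⌉₊ * (L : ℝ) ^ q.2)) ≤ d * (10 * (2 * M * (L : ℝ) ^ s)) := mul_le_mul_of_nonneg_left h3 (by positivity)
      linarith
    have hdM : (1 : ℝ) ≤ d * M * (L : ℝ) ^ s := by
      have := one_le_mul_of_one_le_of_one_le hdR hM1
      exact one_le_mul_of_one_le_of_one_le this hLs1
    have hdMα : α₀ ≤ d * M * (L : ℝ) ^ s * α₀ := by nlinarith
    have hsmall : (20 * d * M * (L : ℝ) ^ s + 1) * α₀ ≤ 1 / 2 := by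
      have h1 : (20 * d * M * (L : ℝ) ^ s + 1) * α₀ ≤ 21 * d * (L : ℝ) ^ s * (M * α₀) := by linarith
      have h2 : 21 * d * (L : ℝ) ^ s * (M * α₀) ≤ 21 * d * (L : ℝ) ^ s * (1 / (42 * d * (L : ℝ) ^ s)) :=
        mul_le_mul_of_nonneg_left hMα' (by positivity)
      have h3 : 21 * (d : ℝ) * (L : ℝ) ^ s * (1 / (42 * d * (L : ℝ) ^ s)) = 1 / 2 := by field_simp; ring
      linarith
    -- the clause with constant `C₀ := (84dL^s + 1)·M·α₀`, then re-read and weakened to `C`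
    have hC₀ : 4 * (20 * d * M * (L : ℝ) ^ s + 1) * α₀ < (84 * d * (L : ℝ) ^ s + 1) * M * α₀ := by
      have := mul_pos (lt_of_lt_of_le one_pos hM1) hα₀
      linarith
    have h1 := reg335Cube_lowIndex_of_plaq hU1 hη hL1 q.2 hα₀.le (by positivity) hsmall h44 hrad hC₀
    refine reg335Cube_mono (shiftT d) (byDir U₀) hξ ?_ h1
    have hLj2 : (((L : ℕ) : ℝ) ^ q.2) ^ 2 ≤ ((L : ℝ) ^ s) ^ 2 := pow_le_pow_left₀ (by positivity) hLj 2
    have h2 : (84 * d * (L : ℝ) ^ s + 1) * M * α₀ * (((L : ℕ) : ℝ) ^ q.2) ^ 2 ≤ (84 * d * (L : ℝ) ^ s + 1) * M * α₀ * ((L : ℝ) ^ s) ^ 2 :=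
      mul_le_mul_of_nonneg_left hLj2 (by positivity)
    linarith
  · -- INDEX `j ≥ s + 1`: Proposition 6 at a print cube of index `j − s`
    have hm1 : 1 ≤ m := by omega
    obtain ⟨c, hcP, hck, hQc, hcM⟩ :=
      exists_printCube_over_classCube_of_sep hd1 hL hρ₀ hs hDS hM (j := q.2) (m := m) hsj hjm hcube hsubΩ
    -- the auxiliary lawful datum with `(k, η, Ω) = (m, i.η, i.Ω)`
    let i' : ZdIdx d L :=
      { η := i.η, hη := i.hη, k := m, hk := hm1, Ω := i.Ω, hΩ := i.hΩ,
        Λs := fun _ j => {_y | j = 0}, Λb := fun _ _ => ∅,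
        hbox := fun _ _ _ _ c hc => ((Set.mem_empty_iff_false c).1 hc).elim,
        hclass := fun _ _ _ _ c hc => ((Set.mem_empty_iff_false c).1 hc).elim,
        htower := fun j _ y hy x _ => by
          have hj0 : j = 0 := hy
          rw [hj0, hΩ0]; exact Set.mem_univ x,
        hpart := fun x _ => ⟨0, Nat.zero_le _, x, rfl, fun μ => by simp only [tlo_zero, thi_zero]; exact ⟨le_rfl, le_rfl⟩⟩ }
    have hP := (prop6Printed_zdCubP_iff (𝔸 := 𝔸) (fun _ : Unit => i') ρ₀ B₁ c₁).1 (hP6 _) () α₀ hα₀ ⟨U₀, hU₀⟩ hIn c hcP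
    have hcMR : (c.M : ℝ) ≤ (20 * (L : ℝ) ^ s + 2 * ρ₀) * M := by
      have h2 : 10 * ⌈M⌉₊ * (L : ℝ) ^ s + 2 * ρ₀ ≤ (20 * (L : ℝ) ^ s + 2 * ρ₀) * M := by
        have e1 := mul_le_mul_of_nonneg_right hceil (le_trans zero_le_one hLs1)
        have e2 := mul_le_mul_of_nonneg_left hM1 hρ0.le
        linarith
      exact hcM.trans h2
    have hpos : 0 < 7 * d * (L : ℝ) ^ 2 * (20 * (L : ℝ) ^ s + 2 * ρ₀) := by positivity
    have hthr : 7 * d * (L : ℝ) ^ 2 * c.M * α₀ ≤ c₁ := by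
      have h1 : 7 * d * (L : ℝ) ^ 2 * c.M * α₀ ≤ 7 * d * (L : ℝ) ^ 2 * ((20 * (L : ℝ) ^ s + 2 * ρ₀) * M) * α₀ := by
        apply mul_le_mul_of_nonneg_right _ hα₀.le
        exact mul_le_mul_of_nonneg_left hcMR (by positivity)
      have h2 : 7 * d * (L : ℝ) ^ 2 * ((20 * (L : ℝ) ^ s + 2 * ρ₀) * M) * α₀ = 7 * d * (L : ℝ) ^ 2 * (20 * (L : ℝ) ^ s + 2 * ρ₀) * (M * α₀) := by ring
      have h3 : 7 * d * (L : ℝ) ^ 2 * (20 * (L : ℝ) ^ s + 2 * ρ₀) * (M * α₀) ≤ c₁ :=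
        calc 7 * d * (L : ℝ) ^ 2 * (20 * (L : ℝ) ^ s + 2 * ρ₀) * (M * α₀)
            ≤ 7 * d * (L : ℝ) ^ 2 * (20 * (L : ℝ) ^ s + 2 * ρ₀) * (c₁ / (7 * d * (L : ℝ) ^ 2 * (20 * (L : ℝ) ^ s + 2 * ρ₀))) :=
              mul_le_mul_of_nonneg_left hMα'' hpos.le
          _ = c₁ := by field_simp
      linarith
    have hG : GaugedBoundB8 L i.η U₀ c (7 * d * (L : ℝ) ^ 2 * B₁ * c.M * α₀) := hP hthr
    -- the bridge at scale `L^{j−s}η` with constant `r̄ + Mα₀`, `r̄ = 7dL²B₁(20L^s + 2ρ₀)Mα₀`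
    have hrC : 7 * d * (L : ℝ) ^ 2 * B₁ * c.M * α₀ < 7 * d * (L : ℝ) ^ 2 * B₁ * (20 * (L : ℝ) ^ s + 2 * ρ₀) * M * α₀ + M * α₀ := by
      have h1 : 7 * d * (L : ℝ) ^ 2 * B₁ * c.M * α₀ ≤ 7 * d * (L : ℝ) ^ 2 * B₁ * ((20 * (L : ℝ) ^ s + 2 * ρ₀) * M) * α₀ := by
        apply mul_le_mul_of_nonneg_right _ hα₀.le
        exact mul_le_mul_of_nonneg_left hcMR (by positivity)
      have h2 : 0 < M * α₀ := mul_pos (lt_of_lt_of_le one_pos hM1) hα₀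
      linarith
    have hres := reg335Cube_of_gaugedBoundB8 hd2 hL hη c hrC hG hQc
    -- re-read at scale `Lʲη = L^s · L^{j−s}η`
    have hC'0 : 0 ≤ 7 * d * (L : ℝ) ^ 2 * B₁ * (20 * (L : ℝ) ^ s + 2 * ρ₀) * M * α₀ + M * α₀ := by positivity
    have hres2 := reg335Cube_rescale (shiftT d) (byDir U₀) (Λ := (L : ℝ) ^ s) (scaleLen_pos hL0 hη c.k) hLs1 hC'0 hres
    have hsc : (L : ℝ) ^ s * scaleLen (L : ℝ) i.η c.k = scaleLen (L : ℝ) i.η q.2 := by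
      rw [hck, scaleLen, scaleLen, ← mul_assoc, ← pow_add, Nat.add_sub_cancel' hsj.le]
    rw [hsc] at hres2
    refine reg335Cube_mono (shiftT d) (byDir U₀) hξ ?_ hres2
    have h3 : (7 * d * (L : ℝ) ^ 2 * B₁ * (20 * (L : ℝ) ^ s + 2 * ρ₀) * M * α₀ + M * α₀) * ((L : ℝ) ^ s) ^ 2
        = 7 * d * (L : ℝ) ^ 2 * B₁ * (20 * (L : ℝ) ^ s + 2 * ρ₀) * ((L : ℝ) ^ s) ^ 2 * M * α₀ + M * α₀ * ((L : ℝ) ^ s) ^ 2 := by ring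
    have h4 : M * α₀ * ((L : ℝ) ^ s) ^ 2 ≤ (84 * d * (L : ℝ) ^ s + 1) * M * α₀ * ((L : ℝ) ^ s) ^ 2 := by
      have : (1 : ℝ) ≤ 84 * d * (L : ℝ) ^ s + 1 := by
        have : (0 : ℝ) ≤ 84 * d * (L : ℝ) ^ s := by positivity
        linarith
      have hp : 0 ≤ M * α₀ * ((L : ℝ) ^ s) ^ 2 := by positivity
      nlinarith
    linarith

/-- **`∃`-PACKAGING** of `prop6At_bgZd_lawMember_of_prop6Printed` (any admissible `s`): positive `c35, c₆`, `K₆ = 1`, `M₃ = 11d + 1`.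
[cite: Balaban1985RegularSpaces, Prop. 6 p.99, (1.33) p.82, (1.3)–(1.4) p.77; Balaban1985BackgroundPropagators, (3.35) p.396] -/
theorem exists_prop6At_bgZd_lawMember_of_prop6Printed (hd2 : 2 ≤ d) {L : ℕ} (hL : 2 ≤ L) {ρ₀ : ℕ} (hρ₀ : 1 ≤ ρ₀) {s : ℕ} (hs : 4 * ρ₀ * L ≤ L ^ s)
    {B₁ c₁ : ℝ} (hB₁ : 0 ≤ B₁) (hc₁ : 0 < c₁)
    (hP6 : ∀ {ι : Type} (f : ι → ZdIdx d L), B8.Prop6Printed d (L : ℝ) B₁ c₁ (fun j => zdCubP 𝔸 L ρ₀ (f j))) :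
    ∃ c35 c₆ K₆ M₃ : ℝ, 0 < c35 ∧ 0 < c₆ ∧ 0 < K₆ ∧ 0 < M₃ ∧
      ∀ (M : ℝ) (i : ZdIdx d L) (m : ℕ), i.Ω 0 = Set.univ → DomainSeq L i.Ω → M₃ ≤ M →
        Prop6At (bgZd 𝔸 L) L memZd (ιCfgZd 𝔸 L) c35 c₆ K₆ M i m := by
  have hdR : (1 : ℝ) ≤ d := by exact_mod_cast (le_trans one_le_two hd2)
  have hLR : (2 : ℝ) ≤ L := by exact_mod_cast hL
  have hρR : (1 : ℝ) ≤ ρ₀ := by exact_mod_cast hρ₀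
  have hd0 : (0 : ℝ) < d := by linarith
  have hL0 : (0 : ℝ) < L := by linarith
  have hρ0 : (0 : ℝ) < ρ₀ := by linarith
  refine ⟨(7 * d * (L : ℝ) ^ 2 * B₁ * (20 * (L : ℝ) ^ s + 2 * ρ₀) + 84 * d * (L : ℝ) ^ s + 1) * ((L : ℝ) ^ s) ^ 2,
    min (1 / (42 * d * (L : ℝ) ^ s)) (c₁ / (7 * d * (L : ℝ) ^ 2 * (20 * (L : ℝ) ^ s + 2 * ρ₀))), 1, 11 * d + 1,
    by positivity, lt_min (by positivity) (by positivity), one_pos, by positivity, fun M i m hΩ0 hDS hM => ?_⟩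
  exact prop6At_bgZd_lawMember_of_prop6Printed hd2 hL hρ₀ hs hB₁ hc₁ hP6 hM i hΩ0 hDS m

end AtFrame

/-! ## §4 The unconditional form: `d ≥ 2`, `L ≥ 5` odd -/

section Holds

variable {𝔸 : Type} [CStarAlgebra 𝔸] [Nontrivial 𝔸]

/-- ★★★ **[B8] PROPOSITION 6's PRINTED APPLICATION AT PRINT's ADMITTED MEMBERS, UNCONDITIONAL** (`d ≥ 2`, `L ≥ 5` odd, any nontrivial C⋆-algebra `𝔸`): there are
`c35, c₆, K₆, M₃ > 0` such that for every `i : ZdIdx d L` with `Ω₀ = ℤᵈ` and the domain laws (1.3)–(1.4) (`DomainSeq L i.Ω`), every block parameter `M ≥ M₃`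
and every truncation `m`, dag-n06-b's junction binder `Prop6At (bgZd 𝔸 L) L memZd (ιCfgZd 𝔸 L) c35 c₆ K₆ M i m` — «U₀ ∈ 𝔄_m({Ω_j}, α₀), Mα₀ ≤ c₆ ⇒ U₀ satisfies
the regularity condition (3.35) in [4] on the p. 396 cube class, O(1)Mα₀ = c35·M·K₆α₀» — HOLDS: §3 with `s := 4ρ₀L` (`4ρ₀L ≤ L^{4ρ₀L}`) ∘
`B8Prop6PrintedZdCubPGamma.prop6Printed_zdCubP_γ_holds`.  The second clause of (1.33) is thereby dropped, as print says, at the frame of record.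
[cite: Balaban1985RegularSpaces, Prop. 6 (1.135)–(1.138) p.99, (1.33) p.82, (1.3)–(1.4) p.77, p.98; Balaban1985BackgroundPropagators, (3.35) p.396] -/
theorem prop6At_bgZd_lawMember_holds (hd2 : 2 ≤ d) {L : ℕ} (hL5 : 5 ≤ L) (hodd : Odd L) :
    ∃ c35 c₆ K₆ M₃ : ℝ, 0 < c35 ∧ 0 < c₆ ∧ 0 < K₆ ∧ 0 < M₃ ∧
      ∀ (M : ℝ) (i : ZdIdx d L) (m : ℕ), i.Ω 0 = Set.univ → DomainSeq L i.Ω → M₃ ≤ M →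
        Prop6At (bgZd 𝔸 L) L memZd (ιCfgZd 𝔸 L) c35 c₆ K₆ M i m := by
  obtain ⟨ρ₀, B₀, c₁, hρ₀, hB₀, hc₁, H⟩ := prop6Printed_zdCubP_γ_holds (𝔸 := 𝔸) hd2 hL5 hodd
  have hL : 2 ≤ L := le_trans (by norm_num) hL5
  have hB₁ : 0 ≤ 5 * (d : ℝ) * L * B₀ := by
    have : (0 : ℝ) ≤ B₀ := le_trans zero_le_one hB₀
    positivity
  have hs : 4 * ρ₀ * L ≤ L ^ (4 * ρ₀ * L) := (Nat.lt_pow_self (by omega : 1 < L)).le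
  exact exists_prop6At_bgZd_lawMember_of_prop6Printed hd2 hL hρ₀ hs hB₁ hc₁ (fun f => H f)

/-- ★★★ **THE N05-ROAD BINDER SHAPE** (member suppliers keyed on the law members `i.Ω 0 = univ`, with the domain laws available as `DomainSeq L i.Ω`): for `d ≥ 2`,
`L ≥ 5` odd and any further law `P` on the datum (e.g. NODE 00's `IdxB8LawsB θ.L`), `∃ c35 c₆ K₆ M₃ > 0, ∀ (M : ℝ) (i : ZdIdx d L) (m : ℕ), i.Ω 0 = univ → P i →
DomainSeq L i.Ω → M₃ ≤ M → Prop6At (bgZd 𝔸 L) L memZd (ιCfgZd 𝔸 L) c35 c₆ K₆ M i m`.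
[cite: Balaban1985RegularSpaces, Prop. 6 p.99, (1.33) p.82, (1.3)–(1.4) p.77; Balaban1985BackgroundPropagators, (3.35) p.396, Thm 3.3 p.399] -/
theorem prop6At_binder_lawMembers_holds (hd2 : 2 ≤ d) {L : ℕ} (hL5 : 5 ≤ L) (hodd : Odd L) (P : ZdIdx d L → Prop) :
    ∃ c35 c₆ K₆ M₃ : ℝ, 0 < c35 ∧ 0 < c₆ ∧ 0 < K₆ ∧ 0 < M₃ ∧
      ∀ (M : ℝ) (i : ZdIdx d L) (m : ℕ), i.Ω 0 = Set.univ → P i → DomainSeq L i.Ω → M₃ ≤ M →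
        Prop6At (bgZd 𝔸 L) L memZd (ιCfgZd 𝔸 L) c35 c₆ K₆ M i m := by
  obtain ⟨c35, c₆, K₆, M₃, h35, h₆, hK, hM₃, H⟩ := prop6At_bgZd_lawMember_holds (𝔸 := 𝔸) hd2 hL5 hodd
  exact ⟨c35, c₆, K₆, M₃, h35, h₆, hK, hM₃, fun M i m hΩ0 _ hDS hM => H M i m hΩ0 hDS hM⟩

end Holds

end Literature.MathematicalPhysics.QuantumFieldTheory.Balaban1983to89.B8Prop6Reg335ZdLawMember

end
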